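import Mathlib
import HarnessLib
import Literature.MathematicalPhysics.QuantumFieldTheory.OSLorentzInvariance
import Summits.QuantumFields.YangMills.Theorems.NPointIsotropy.Negative.HyperoctahedralPlane

/-!
# Signed permutations of `ℝ⁴` from coordinate permutations and one quarter turn

Support file (registered stub `stub_rotHyper` of the crux `ContinuumLegGivenGap`
`Summit.QuantumFields.YangMills.Theses.ConvexGribovBody.ContinuumLegGivenGap`, line `Sketch`): pure Euclidean
geometry of `ℝ⁴` over Mathlib, the tree's signed permutations `sp τ δ = permIso τ ∘ signFlip δ`
(`NPointIsotropy.Negative.HyperoctahedralPlane`) and the tree's rotation `planeRot 0 t` of the `(x⁰,x¹)`-plane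
(`Literature.MathematicalPhysics.QuantumFieldTheory.OSLorentzInvariance`). No definitions, no notation.

**Main theorem** `stub_rotHyper`. Let `P` be a predicate on the linear isometries of `ℝ⁴` closed under
composition and inverses, holding on every coordinate permutation `piLpCongrLeft σ` and on every rotation
`planeRot 0 t` of the `(x⁰,x¹)`-plane. Then `P A` for every isometry `A` permuting the coordinate axes up to sign
(all `384` signed permutations, no determinant condition).

Proof. (1) The quarter turn `ρ_{π/2} : x ↦ (x¹, -x⁰, x², x³)` preceded by the transposition `x⁰ ↔ x¹` is the
single sign flip of `x¹` (`signFlip_one_eq_permIso_trans_planeRot`). (2) Every single flip is the conjugate of it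
by the transposition `xⁱ ↔ x¹` (`signFlip_single_eq_conj`). (3) A general sign flip `signFlip δ` is the product
of the single flips at the `i` with `δ i` (`signFlip_eq_trans_ite`), the identity being `σ ∘ σ⁻¹`. (4) An
axis-permuting isometry is `permIso τ ∘ signFlip δ` (tree `exists_sp_of_isHyper`).

References: folklore (the hyperoctahedral group `W(B₄)` is generated by `S₄` and one sign change).
-/

noncomputable section

namespace Summit.QuantumFields.YangMills.Theorems.ContinuumLegGivenGap

open Literature.MathematicalPhysics.QuantumFieldTheory
open Summit.QuantumFields.YangMills.Theorems.NPointIsotropy.Negative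

/-- **The flip of `x¹` is a quarter turn after a transposition**: `signFlip` at the single index `1` equals
`ρ_{π/2} ∘ (x⁰ ↔ x¹)`, where `ρ_t = planeRot 0 t` rotates `(x⁰,x¹) ↦ (cos t x⁰ + sin t x¹, -sin t x⁰ + cos t x¹)`:
indeed `(x⁰ ↔ x¹)` sends `x` to `(x¹, x⁰, x², x³)` and `ρ_{π/2}` sends `y` to `(y¹, -y⁰, y², y³)`. [folklore] -/
theorem signFlip_one_eq_permIso_trans_planeRot :
    signFlip (fun j => decide (j = 1)) =
      (permIso (Equiv.swap 0 1)).trans (planeRot (0 : Fin 3) (Real.pi / 2)) := by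
  apply LinearIsometryEquiv.ext
  intro x
  ext j
  fin_cases j <;>
    simp [LinearIsometryEquiv.trans_apply, Equiv.swap_apply_def, sgn]

/-- **Single flips are conjugate under coordinate transpositions**: the sign flip of `xⁱ` is
`(xⁱ ↔ x¹) ∘ (flip of x¹) ∘ (xⁱ ↔ x¹)`. [folklore] -/
theorem signFlip_single_eq_conj (i : Fin 4) :
    signFlip (fun j => decide (j = i)) =
      (permIso (Equiv.swap i 1)).trans
        ((signFlip (fun j => decide (j = 1))).trans (permIso (Equiv.swap i 1))) := by
  apply LinearIsometryEquiv.ext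
  intro x
  ext j
  simp only [LinearIsometryEquiv.trans_apply, signFlip_apply, permIso_apply, Equiv.symm_swap,
    Equiv.swap_apply_self]
  have h : decide (Equiv.swap i 1 j = 1) = decide (j = i) := by
    rw [decide_eq_decide, Equiv.swap_apply_eq_iff, Equiv.swap_apply_right]
  rw [h]

/-- **Sign flips factor into single flips**: `signFlip δ` is the composite over `i = 0, 1, 2, 3` of the single
flip of `xⁱ` if `δ i`, and of the identity otherwise (all factors act coordinatewise and commute). [folklore] -/
theorem signFlip_eq_trans_ite (δ : Fin 4 → Bool) :
    signFlip δ =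
      (if δ 0 then signFlip (fun j => decide (j = 0)) else LinearIsometryEquiv.refl ℝ (EuclideanSpace ℝ (Fin 4))).trans
        ((if δ 1 then signFlip (fun j => decide (j = 1))
          else LinearIsometryEquiv.refl ℝ (EuclideanSpace ℝ (Fin 4))).trans
          ((if δ 2 then signFlip (fun j => decide (j = 2))
            else LinearIsometryEquiv.refl ℝ (EuclideanSpace ℝ (Fin 4))).trans
            (if δ 3 then signFlip (fun j => decide (j = 3))
              else LinearIsometryEquiv.refl ℝ (EuclideanSpace ℝ (Fin 4))))) := by
  have key : ∀ (b : Bool) (i : Fin 4) (y : EuclideanSpace ℝ (Fin 4)) (k : Fin 4),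
      (if b then signFlip (fun j => decide (j = i)) else LinearIsometryEquiv.refl ℝ (EuclideanSpace ℝ (Fin 4)))
          y k = (if b = true ∧ k = i then -1 else 1) * y k := by
    rintro (_ | _) i y k
    · simp
    · by_cases h : k = i <;> simp [h, sgn]
  apply LinearIsometryEquiv.ext
  intro x
  ext j
  simp only [LinearIsometryEquiv.trans_apply, key, signFlip_apply]
  fin_cases j <;> simp [sgn]

/-- **Signed permutations from axis permutations and plane rotations** (registered stub `stub_rotHyper`): a
predicate on the linear isometries of `ℝ⁴` closed under composition and inverses, holding on every coordinate
permutation `piLpCongrLeft σ` and on every `(x⁰,x¹)`-rotation `planeRot 0 t`, holds on every isometry permuting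
the axes up to sign. The identity is `σ ∘ σ⁻¹`; the single flip of `x¹` is `ρ_{π/2} ∘ (x⁰ ↔ x¹)`
(`signFlip_one_eq_permIso_trans_planeRot`); every single flip is a conjugate of it by a transposition
(`signFlip_single_eq_conj`); a sign flip is a product of single flips (`signFlip_eq_trans_ite`); and an
axis-permuting isometry is `permIso τ ∘ signFlip δ` (tree `exists_sp_of_isHyper`). [folklore] -/
theorem stub_rotHyper :
    ∀ (P : (EuclideanSpace ℝ (Fin 4) ≃ₗᵢ[ℝ] EuclideanSpace ℝ (Fin 4)) → Prop),
      (∀ A B, P A → P B → P (A.trans B)) → (∀ A, P A → P A.symm) →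
      (∀ σ : Equiv.Perm (Fin 4), P (LinearIsometryEquiv.piLpCongrLeft 2 ℝ ℝ σ)) →
      (∀ t : ℝ, P (Literature.MathematicalPhysics.QuantumFieldTheory.planeRot (0 : Fin 3) t)) →
      ∀ A : EuclideanSpace ℝ (Fin 4) ≃ₗᵢ[ℝ] EuclideanSpace ℝ (Fin 4),
        (∀ i : Fin 4, ∃ j : Fin 4, A (EuclideanSpace.single i 1) = EuclideanSpace.single j 1 ∨
          A (EuclideanSpace.single i 1) = -EuclideanSpace.single j 1) → P A := by
  intro P hmul hinv hperm hrho A hA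
  -- coordinate permutations (tree vocabulary `permIso`) and the identity
  have hperm' : ∀ σ : Equiv.Perm (Fin 4), P (permIso σ) := fun σ => hperm σ
  have hrefl : P (LinearIsometryEquiv.refl ℝ (EuclideanSpace ℝ (Fin 4))) := by
    have h := hmul _ _ (hperm 1) (hinv _ (hperm 1))
    rwa [LinearIsometryEquiv.self_trans_symm] at h
  -- the single flip of `x¹` is `ρ_{π/2} ∘ (x⁰ ↔ x¹)`
  have hF1 : P (signFlip fun j => decide (j = 1)) := by
    rw [signFlip_one_eq_permIso_trans_planeRot]
    exact hmul _ _ (hperm' _) (hrho _)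
  -- every single flip is a conjugate of it by a transposition
  have hF : ∀ i : Fin 4, P (signFlip fun j => decide (j = i)) := fun i => by
    rw [signFlip_single_eq_conj i]
    exact hmul _ _ (hperm' _) (hmul _ _ hF1 (hperm' _))
  have hG : ∀ (b : Bool) (i : Fin 4),
      P (if b then signFlip (fun j => decide (j = i))
        else LinearIsometryEquiv.refl ℝ (EuclideanSpace ℝ (Fin 4))) := by
    rintro (_ | _) i
    · simpa using hrefl
    · simpa using hF i
  -- `A` is the signed permutation `permIso τ ∘ signFlip δ`
  obtain ⟨τ, δ, hτδ⟩ := exists_sp_of_isHyper hA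
  have hAeq : A = (signFlip δ).trans (permIso τ) := LinearIsometryEquiv.ext hτδ
  rw [hAeq]
  refine hmul _ _ ?_ (hperm' τ)
  rw [signFlip_eq_trans_ite δ]
  exact hmul _ _ (hG _ 0) (hmul _ _ (hG _ 1) (hmul _ _ (hG _ 2) (hG _ 3)))

end Summit.QuantumFields.YangMills.Theorems.ContinuumLegGivenGap

end
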